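import Mathlib
import Summits.Ventures.FusionMHD.Models.TearingFRS1
import Literature.Analysis.ODE.RationalTaylorMajorant
import Literature.Analysis.ODE.RegularSingularLogBranchScalar
import Literature.MathematicalPhysics.MHD.TearingOuterRegion
import HarnessLib

/-!
# F3.r3 instance «TearingFRS1.M4»: the (4,2) harmonic at the q = 2 surface of the PRINTED profile — the scaled
# marginal tearing equation with `m² = 16` and its resonant normal form, local data PROVED admissible

LADDER-GRIDFUSION rung F3.r3 (models/F3-SCOPING.md §7f, model-6 g5): the `m = 4` member of the `σ = 3/7` family.
MODEL M₄ (MODELLED column): EXACTLY the model of row #13 — straight cylinder, zero β, single helicity, the PRINTED profile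
`q(r) = (7/5)(1 + r²/r_a²)` of Ham–Connor–Cowley–Hastie–Hender–Liu, arXiv:1308.2070 §4 («`q₀ = 1.4`, `λ = 1`»; the
`ν = 1` peaked current of Furth–Rutherford–Selberg 1973) — but the mode `(m, n) = (4, 2)`, the second harmonic resonant at
THE SAME surface `q(r_s) = 2`, `r_s² = (3/7) r_a²`. Same `σ = λ r_s²/r_a² = 3/7`, so the scaled equation differs from
`TearingFRS1.IsScaledOuterSolution` only in the centrifugal term:

  `ψ_uu + ψ_u/u − 16ψ/u² − 560 ψ/((7 + 3u²)²(u² − 1)) = 0`   (`IsScaledOuterSolution`),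

and the resonant normal form at `u = 1 + x` has the same `p = x/(1+x)` (`TearingFRS1.pc`), the same denominator `Q` and
the numerator `P` below (`q(0) = −14/5`, `κ = 14/5`). Float preview (`teargen/preview_scan.py`, VALIDATED class):
`r_s Δ′_{4,2} ≈ −4.394` (no wall and wall at `6 r_s` alike), `−4.403` (wall at `2 r_s`): the (4,2) harmonic is on the
STABLE side of the printed criterion at the surface where (2,1) is not (`r_s Δ′_{2,1} = +5.126`, row #13).

THIS FILE (pattern of `TearingFRS1M3.lean`): `P`, degree, numerator sum `≤ 61/10` at `ρ = 1/8`; `qc = ratTaylorCoeff P Q` with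
`|qc n| ≤ 15·8ⁿ` and the sum on `|x| < 1/8`; **`isScalarLogData : IsScalarLogData pc qc p q 8 15 (1/8)`**; `q_eq`;
`IsScaledOuterSolution` and `local_normal_form`. MODEL-VALIDITY row: MV-7R. [instance data]
-/

noncomputable section

open Finset Filter Metric Polynomial
open scoped Topology

namespace Summit.Ventures.FusionMHD.Models

namespace TearingFRS1

namespace M4

/-! ### The local coefficient data at the rational surface `u = 1` (`x = u − 1`), `m² = 9` -/

/-- Numerator of `q(x)` for `m = 4`: `P = (−16x(3x²+6x+10)²(x+2) − 560(1+x)²)/200`. [instance data] -/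
def P : ℝ[X] :=
  C (-14 / 5) + C (-108 / 5) * X + C (-30) * X ^ 2 + C (-624 / 25) * X ^ 3 + C (-336 / 25) * X ^ 4
    + C (-108 / 25) * X ^ 5 + C (-18 / 25) * X ^ 6

/-- `deg P ≤ 6`. [instance data] -/
theorem P_natDegree_le : P.natDegree ≤ 6 := by unfold P; compute_degree

/-- numerator sum of `P` at `ρ = 1/8`: `≤ 61/10` (exact value `6.0209…`). [instance data] -/
theorem P_sum : ∑ i ∈ range (6 + 1), ‖P.coeff i‖ * (1 / 8 : ℝ) ^ i ≤ 61 / 10 := by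
  simp only [P, Finset.sum_range_succ, Finset.sum_range_zero, coeff_add, coeff_C_mul, coeff_X_pow,
    coeff_X]
  norm_num

/-! ### Taylor data of `q = P/Q` (division recursion + majorant + convergence) -/

/-- The coefficient sequence of `q = P/Q` for `m = 4`. [instance data] -/
def qc : ℕ → ℝ := Literature.Analysis.ODE.ratTaylorCoeff P Q

/-- `q(x) = P(x)/Q(x)` (= `−16x/(1+x)² − 560/((3x²+6x+10)²(x+2))`, see `q_eq`). [instance data] -/
def q (x : ℝ) : ℝ := P.eval x / Q.eval x

/-- Taylor data of `q`: `|qc n| ≤ (427/30)·8ⁿ` and `Σ xⁿ qc n = P(x)/Q(x)` on `|x| < 1/8`. [instance data] -/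
theorem q_taylor : (∀ n, ‖qc n‖ ≤ (61 / 10) / (1 - 4 / 7) * (1 / 8 : ℝ)⁻¹ ^ n) ∧
    ∀ x : ℝ, ‖x‖ < 1 / 8 → Q.eval x ≠ 0 ∧ HasSum (fun n => x ^ n * qc n) (P.eval x / Q.eval x) :=
  Literature.Analysis.ODE.ratTaylor_of_natDegree_le P Q Q_coeff_zero (by norm_num) Q_natDegree_le
    P_natDegree_le Q_margin (by norm_num) P_sum

/-- `qc 0 = −14/5` (the `m²`-term vanishes at the surface), so `κ = 14/5`. [instance data] -/
theorem qc_zero : qc 0 = -14 / 5 := by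
  rw [qc, Literature.Analysis.ODE.ratTaylorCoeff_eq]
  simp [P]

/-- **THE LOCAL DATA ARE ADMISSIBLE** (`m = 4`): `IsScalarLogData pc qc p q 8 15 (1/8)`. [instance data] -/
theorem isScalarLogData : Literature.Analysis.ODE.IsScalarLogData pc qc p q 8 15 (1 / 8) where
  a_pos := by norm_num
  K_nonneg := by norm_num
  ρ₀_pos := by norm_num
  norm_pc_le k _ := by
    have h := p_taylor.1 k
    have h8 : (1 / 8 : ℝ)⁻¹ = 8 := by norm_num
    rw [h8] at h
    refine h.trans (mul_le_mul_of_nonneg_right (by norm_num) (by positivity))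
  norm_qc_le k _ := by
    have h := q_taylor.1 k
    have h8 : (1 / 8 : ℝ)⁻¹ = 8 := by norm_num
    rw [h8] at h
    refine h.trans (mul_le_mul_of_nonneg_right (by norm_num) (by positivity))
  pc_zero := pc_zero
  hasSum_p x hx := by
    have h := (p_taylor.2 x hx).2
    have he : P₁.eval x / Q₁.eval x = p x := by simp [P₁, Q₁, p]
    rwa [he] at h
  hasSum_q x hx := (q_taylor.2 x hx).2

/-! ### Closed forms and the link with the scaled model equation -/

/-- `P(x) = (−16x(3x²+6x+10)²(x+2) − 560(1+x)²)/200`. [instance data] -/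
theorem P_eval (x : ℝ) : P.eval x = (-16 * x * (3 * x ^ 2 + 6 * x + 10) ^ 2 * (x + 2) - 560 * (1 + x) ^ 2) / 200 := by
  simp only [P, eval_add, eval_mul, eval_C, eval_X, eval_pow]
  ring

/-- CLOSED FORM of the local coefficient (`m = 4`): `q(x) = −16x/(1+x)² − 560/((3x²+6x+10)²(x+2))` (away from
`x = −1, −2`). [instance data] -/
theorem q_eq {x : ℝ} (hx1 : 1 + x ≠ 0) (hx2 : x + 2 ≠ 0) :
    q x = -16 * x / (1 + x) ^ 2 - 560 / ((3 * x ^ 2 + 6 * x + 10) ^ 2 * (x + 2)) := by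
  have h3 : (3 * x ^ 2 + 6 * x + 10 : ℝ) ≠ 0 := by nlinarith [sq_nonneg (x + 1)]
  have hQ := Q_eval_ne_zero hx1 hx2
  rw [q, div_eq_iff hQ, P_eval, Q_eval]
  set t : ℝ := 3 * x ^ 2 + 6 * x + 10 with ht
  field_simp

/-- **The scaled marginal tearing equation of MODEL M₄** (the PRINTED profile `q = (7/5)(1 + r²/r_a²)`, mode `(4,2)`,
`r_s² = (3/7) r_a²`; in `u = r/r_s`): `ψ_uu + ψ_u/u − 16ψ/u² + C(u)ψ = 0` with the coupling `C` of row #13; first-order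
form on a set avoiding `u ∈ {0, ±1}` [Miyamoto2007 §9.4.1 eq. (9.61), `γ² → 0`].
[model instance predicate — OUR object, not a cited statement] -/
def IsScaledOuterSolution (ψ ψ' : ℝ → ℝ) (s : Set ℝ) : Prop :=
  ∀ u ∈ s, HasDerivAt ψ (ψ' u) u ∧
    HasDerivAt ψ' (-(ψ' u) / u + (16 / u ^ 2 + 560 / ((7 + 3 * u ^ 2) ^ 2 * (u ^ 2 - 1))) * ψ u) u

/-- THE LOCAL NORMAL FORM (`m = 4`): at `u = 1 + x` (`x ∉ {0, −1, −2}`) the model right-hand side is the unique `D` with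
`x D + p(x) ψ' + q(x) ψ = 0`. [instance data] -/
theorem local_normal_form {x ψ₀ ψ₁ D : ℝ} (hx0 : x ≠ 0) (hx1 : 1 + x ≠ 0) (hx2 : x + 2 ≠ 0) :
    x * D + p x * ψ₁ + q x * ψ₀ = 0 ↔
      D = -ψ₁ / (1 + x) + (16 / (1 + x) ^ 2 + 560 / ((7 + 3 * (1 + x) ^ 2) ^ 2 * ((1 + x) ^ 2 - 1))) * ψ₀ := by
  have h3 : (3 * x ^ 2 + 6 * x + 10 : ℝ) ≠ 0 := by nlinarith [sq_nonneg (x + 1)]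
  have h7 : (7 + 3 * (1 + x) ^ 2 : ℝ) = 3 * x ^ 2 + 6 * x + 10 := by ring
  have hu : ((1 + x) ^ 2 - 1 : ℝ) = x * (x + 2) := by ring
  have hid : x * (-ψ₁ / (1 + x) + (16 / (1 + x) ^ 2 + 560 / ((7 + 3 * (1 + x) ^ 2) ^ 2 * ((1 + x) ^ 2 - 1))) * ψ₀)
      + p x * ψ₁ + q x * ψ₀ = 0 := by
    rw [q_eq hx1 hx2, p, h7, hu]
    set t : ℝ := 3 * x ^ 2 + 6 * x + 10 with ht
    field_simp
    ring
  constructor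
  · intro h
    have hsub : x * (D - (-ψ₁ / (1 + x)
        + (16 / (1 + x) ^ 2 + 560 / ((7 + 3 * (1 + x) ^ 2) ^ 2 * ((1 + x) ^ 2 - 1))) * ψ₀)) = 0 := by
      linear_combination h - hid
    rcases mul_eq_zero.1 hsub with h0 | h0
    · exact absurd h0 hx0
    · exact sub_eq_zero.1 h0
  · intro h
    rw [h]
    exact hid

end M4

end TearingFRS1

end Summit.Ventures.FusionMHD.Models

end
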